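import Summits.ResolutionOfSingularities.ResolutionOfSingularities.Theorems.WeightedInvariantContactCylinderGlobalMoveDictionary
import HarnessLib

/-!
# Finiteness of the tie points — the GLOBAL TRANSFORM of `f` in the global move and its `t⁻¹`-primitivity (door
# `HypersurfaceCentreConstruction`, stmt-ResolutionOfSingularities-19897, route `WeightedInvariant`, P3 rung `KeyRungGrLE 3 p`, letter `τ`)

[OURS · L1 W4.3 · cell `res-hironaka`, HUMAN RULING D-0089] Helper file `--supports stmt-ResolutionOfSingularities-19897` (line
`local-engine` of res-L1-w43-plan-1, spec `L/res-type-047/D2-INCHART-SPEC-v2.md` §2 — the binders `hfg`, `hG`, `hcontr` of the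
ring-level in-chart theorem `TieFinite.finite_tiePrimes`).  `A` a commutative ring, `U : Fin m → A`, weights `W`,
`B = extReesAlgebra (weightedMonomialIdeal U W)` the global move, `f ∈ 𝒥ₐ(U, W)`, `a ≥ 1`.
* `TieFinite.exists_transform` — the transform `G = f tᵃ ∈ B`: `f = (t⁻¹)ᵃ · G`.
* `TieFinite.coe_transform` — ANY `G` with `f = (t⁻¹)ᵃ G` is the Laurent monomial `C f · Tᵃ`; `coeff_transform`.
* `TieFinite.tInv_dvd_transform_iff` — `t⁻¹ ∣ G ↔ f ∈ 𝒥ₐ₊₁(U, W)` (res-D-brk-1's coefficient criterion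
  `ContactCylinder.tInv_dvd_iff_forall_coeff_mem_weightedMonomialIdeal`, p542453, on a monomial).
* `TieFinite.coeff_transform_contracted` — the `hcontr` binder of `not_tInv_dvd_map_of_forall` / `finite_tiePrimes` holds for THIS
  `G` as soon as `φ f ∉ 𝒥ₐ₊₁(φ ∘ U, W)` (the only non-zero coefficient of `G` is `f`; no contractedness of the pieces is used).
* `TieFinite.weightedMonomialIdeal_le_span_pow` — with all weights `≤ r` (`r ≥ 1`), `𝒥_{rn+1}(U, W) ≤ (U)^{n+1}`; hence
  `not_mem_weightedMonomialIdeal_of_not_mem_pow`: `f ∉ 𝔪^{n+1} ⇒ f ∉ 𝒥_{rn+1}` at a local ring where `U ⊆ 𝔪` — the weighted order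
  of `f` at the generic point `η` of the curve is exactly `rn` when `ord_η f = n`.

[OURS] Replaces the role of NO printed item; NOT a statement of the manuscript under review [claim: Hironaka2017, status:
under-review].  AI work, weaker than expert review.  Def-free.

## References

* J. Włodarczyk, *Functorial resolution except for toroidal locus. Toroidal compactification*, Def. 5.1.1; *Functorial resolution by
  torus actions*, §3.3 (the transform `σ^c(f) = t^{a} f`). [Wlodarczyk2022]
-/

noncomputable section

set_option linter.dupNamespace false -- mandated namespace `Summit.<Summit>.<Problem>` of this single-conjunct summit

open IsLocalRing Literature.AlgebraicGeometry.Resolution LaurentPolynomial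
open Summit.ResolutionOfSingularities.ResolutionOfSingularities.Theorems

namespace Summit.ResolutionOfSingularities.ResolutionOfSingularities.Cruxes.HypersurfaceCentreConstruction.LocalEngine

namespace TieFinite

section Transform

variable {A : Type} [CommRing A] {m : ℕ} (U : Fin m → A) (W : Fin m → ℕ)

/-- **The global transform** `G = f tᵃ` of `f ∈ 𝒥ₐ(U, W)` (`a ≥ 1`): `f = (t⁻¹)ᵃ · G` in `B`. [cite: Wlodarczyk2022, §3.3] -/
theorem exists_transform {f : A} {a : ℕ} (ha : 0 < a) (hf : f ∈ weightedMonomialIdeal U W a) :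
    ∃ G : extReesAlgebra (weightedMonomialIdeal U W), (G : A[T;T⁻¹]) = C f * T (a : ℤ) ∧
      algebraMap A (extReesAlgebra (weightedMonomialIdeal U W)) f = extReesAlgebra.tInv (weightedMonomialIdeal U W) ^ a * G := by
  refine ⟨⟨C f * T (a : ℤ), extReesAlgebra.C_mul_T_mem _ ha hf⟩, rfl, Subtype.ext ?_⟩
  change C f = T (-1) ^ a * (C f * T (a : ℤ))
  rw [mul_left_comm, T_pow, ← T_add]
  simp

/-- **Any `G` with `f = (t⁻¹)ᵃ G` is the Laurent monomial `f Tᵃ`.** [folklore] -/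
theorem coe_transform {f : A} {a : ℕ} {G : extReesAlgebra (weightedMonomialIdeal U W)}
    (hfg : algebraMap A (extReesAlgebra (weightedMonomialIdeal U W)) f = extReesAlgebra.tInv (weightedMonomialIdeal U W) ^ a * G) :
    (G : A[T;T⁻¹]) = C f * T (a : ℤ) := by
  have h := congrArg Subtype.val hfg
  change C f = T (-1) ^ a * (G : A[T;T⁻¹]) at h
  have hT : (T (a : ℤ) : A[T;T⁻¹]) * T (-1) ^ a = 1 := by rw [T_pow, ← T_add]; simp
  calc (G : A[T;T⁻¹]) = T (a : ℤ) * T (-1) ^ a * (G : A[T;T⁻¹]) := by rw [hT, one_mul]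
    _ = C f * T (a : ℤ) := by rw [mul_assoc, ← h, mul_comm]

/-- The coefficients of the transform: `G_k = f` for `k = a`, `0` otherwise. [folklore] -/
theorem coeff_transform {f : A} {a : ℕ} {G : extReesAlgebra (weightedMonomialIdeal U W)}
    (hfg : algebraMap A (extReesAlgebra (weightedMonomialIdeal U W)) f = extReesAlgebra.tInv (weightedMonomialIdeal U W) ^ a * G)
    (k : ℤ) : (G : A[T;T⁻¹]).coeff k = if (a : ℤ) = k then f else 0 := by
  rw [coe_transform U W hfg, ← single_eq_C_mul_T, AddMonoidAlgebra.coeff_single, Finsupp.single_apply]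

/-- **`t⁻¹`-primitivity of the transform**: `t⁻¹ ∣ G ↔ f ∈ 𝒥ₐ₊₁(U, W)`. [cite: Wlodarczyk2022, Def. 5.1.1] -/
theorem tInv_dvd_transform_iff {f : A} {a : ℕ} {G : extReesAlgebra (weightedMonomialIdeal U W)}
    (hfg : algebraMap A (extReesAlgebra (weightedMonomialIdeal U W)) f = extReesAlgebra.tInv (weightedMonomialIdeal U W) ^ a * G) :
    extReesAlgebra.tInv (weightedMonomialIdeal U W) ∣ G ↔ f ∈ weightedMonomialIdeal U W (a + 1) := by
  rw [ContactCylinder.tInv_dvd_iff_forall_coeff_mem_weightedMonomialIdeal]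
  constructor
  · intro h
    have h1 := h (a + 1)
    rw [coeff_transform U W hfg, if_pos (by push_cast; ring)] at h1
    exact h1
  · intro hf n
    rw [coeff_transform U W hfg]
    split_ifs with hn
    · have hn' : n = a + 1 := by omega
      rw [hn']; exact hf
    · exact zero_mem _

/-- **The `hcontr` binder for THIS transform**: along any ring map `φ : A → S`, if `φ f ∉ 𝒥ₐ₊₁(φ ∘ U, W)` then every coefficient of
`G` that lands in `𝒥ₘ(φ ∘ U, W)` already lies in `𝒥ₘ(U, W)` (vacuously: the only non-zero coefficient is `G_a = f`). [folklore] -/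
theorem coeff_transform_contracted {S : Type} [CommRing S] (φ : A →+* S) {f : A} {a : ℕ}
    {G : extReesAlgebra (weightedMonomialIdeal U W)}
    (hfg : algebraMap A (extReesAlgebra (weightedMonomialIdeal U W)) f = extReesAlgebra.tInv (weightedMonomialIdeal U W) ^ a * G)
    (hfS : φ f ∉ weightedMonomialIdeal (fun i => φ (U i)) W (a + 1)) :
    ∀ n : ℕ, φ ((G : A[T;T⁻¹]).coeff ((n : ℤ) - 1)) ∈ weightedMonomialIdeal (fun i => φ (U i)) W n →
      (G : A[T;T⁻¹]).coeff ((n : ℤ) - 1) ∈ weightedMonomialIdeal U W n := by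
  intro n hn
  rw [coeff_transform U W hfg] at hn ⊢
  split_ifs at hn ⊢ with h
  · have hn' : n = a + 1 := by omega
    subst hn'
    exact absurd hn hfS
  · exact zero_mem _

/-- **Weights `≤ r` force degree**: `𝒥_{rn+1}(U, W) ≤ (U)^{n+1}` when `wᵢ ≤ r` for all `i` (a monomial of weight `≥ rn + 1` has degree
`≥ n + 1`). [cite: Wlodarczyk2022, Lemma 2.1.12] -/
theorem weightedMonomialIdeal_le_span_pow {r : ℕ} (hW : ∀ i, W i ≤ r) (n : ℕ) :
    weightedMonomialIdeal U W (r * n + 1) ≤ Ideal.span (Set.range U) ^ (n + 1) := by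
  rw [weightedMonomialIdeal, Ideal.span_le]
  rintro _ ⟨α, hα, rfl⟩
  have hdeg : n + 1 ≤ ∑ i, α i := by
    have hle : ∑ i, W i * α i ≤ r * ∑ i, α i := by
      rw [Finset.mul_sum]
      exact Finset.sum_le_sum fun i _ => Nat.mul_le_mul_right _ (hW i)
    by_contra hlt
    have h1 : ∑ i, α i ≤ n := by omega
    have h2 : r * ∑ i, α i ≤ r * n := Nat.mul_le_mul_left _ h1
    omega
  refine Ideal.pow_le_pow_right hdeg ?_
  have h : ∏ i, U i ^ α i ∈ ∏ i : Fin m, Ideal.span (Set.range U) ^ α i :=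
    Ideal.prod_mem_prod fun i _ => Ideal.pow_mem_pow (Ideal.subset_span (Set.mem_range_self i)) _
  rwa [Finset.prod_pow_eq_pow_sum] at h

/-- **At a local ring with `U ⊆ 𝔪` and weights `≤ r`: `f ∉ 𝔪^{n+1} ⇒ f ∉ 𝒥_{rn+1}(U, W)`** — the weighted order of an element of order
`n` is at most `rn` (so exactly `rn` when `f ∈ 𝒥_{rn}`). [cite: Wlodarczyk2022, Lemma 2.1.12] -/
theorem not_mem_weightedMonomialIdeal_of_not_mem_pow {S : Type} [CommRing S] [IsLocalRing S] (u : Fin m → S)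
    (hu : ∀ i, u i ∈ maximalIdeal S) {r : ℕ} (hW : ∀ i, W i ≤ r) {n : ℕ} {f : S}
    (hf : f ∉ maximalIdeal S ^ (n + 1)) : f ∉ weightedMonomialIdeal u W (r * n + 1) := fun h =>
  hf (Ideal.pow_right_mono (Ideal.span_le.mpr (by rintro _ ⟨i, rfl⟩; exact hu i)) _
    (weightedMonomialIdeal_le_span_pow u W hW n h))

end Transform

end TieFinite

end Summit.ResolutionOfSingularities.ResolutionOfSingularities.Cruxes.HypersurfaceCentreConstruction.LocalEngine

end
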